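import Summits.BirchSwinnertonDyer.BirchSwinnertonDyer.Theorems.EisensteinPrimesMazurMCOnCellBTwistbackUnitLever
import Summits.BirchSwinnertonDyer.BirchSwinnertonDyer.Theorems.EisensteinPrimesMazurMCOnCellBTwistbackOnePartner
import HarnessLib

/-!
# Crux 3 `MazurMCOnCellB` (stmt-BirchSwinnertonDyer-19033) — line `anchor` (bsd-idea-12 g8, lens=embed; NOT registered, W-79)

ANCHOR PRINCIPLE. Vertices: globally minimal curves over `ℚ` at the fixed odd prime `p`. Edges: CERTIFIED HEEGNER
TWO-STEPS `W ⇝ W″` (`TwoStep p W W″`: `W` an X2b-type rank-`0` pair, an admissible `K` with Heegner point and `p ∤ c`,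
a globally minimal model `Wd` of the rank-one twist `E^{(d_K)}`, STEP L at `(W, K)` and the joint upper half over
`(Wd, W″)` — exactly the data of LEAD UnitLever §4 `mazurMainConjectureAt_transfer_of_mazurMainConjectureAt` — to a
rank-`0` multiplicative `W″`). ANCHOR = a rank-`0` multiplicative pair where Mazur's main conjecture is known
(`Anchor p W″`); Wuthrich 2014 Prop. 21 makes every pair with `p ∤ #Ш_an(W″)` and `E[p]` reducible an anchor
(`anchor_of_unit`, via `X2.mazurMainConjectureAt_of_shaAn_unit_of_red`). KERNEL (sorry-free): the main conjecture
propagates from an anchor back along any finite chain of certified two-steps (`anchor_of_reflTransGen`, induction on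
`Relation.ReflTransGen`); hence the crux BY NAME from ONE open statement `UnitAnchorSupply` (every X2b pair reaches a
Wuthrich-unit anchor) — `MazurMCOnCellB_of`; the intermediate `AnchorSupply` (any anchor) is the crux REFORMULATED
(equivalent modulo `PublishedInputs`, both directions proved). The open statement is WEAKER — in the SUPPLY dimension only (V56 P2):
every edge still carries 1× STEP L and 1× `JointUpperBoundAt`, both OPEN (= the Thm-D gap) — than each single-road supply typed so far (twistunit v3.1
`HeegnerUnitTwist` = a unit at distance 2 through the box member; record v4 `stub_upperPartner` = the upper half at
distance 1; UnitLever §4 = one two-step): any of them gives a chain of length ≤ 1.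
NUMERICS (Cruxes/MazurMCOnCellB/ANCHOR-CENSUS-g8.md, this gen, 76/76 validation rows exact vs Cremona): at `p = 3`,
unit anchors two admissible twists away exist for 46/46 computed X2b classes (N ≤ 900, |d d″| ≤ 79993; 84/94 rank-0 ends are
units at the optimal member; rev 3 of the census; 7 of the 53 classes have no admissible two-step with 4√N·|d d″| ≤ 8·10⁶),
and one twist away from 42/42 X2c∩GV classes (N ≤ 4132, |d| ≤ 551). BARRIER HONESTY (V55 P3): every edge of the graph
carries the Keller–Yin-Thm-D-at-`p ∥ N` certification (STEP L / co-STEP L, item 27489) — it does NOT evade the Thm-D gap; what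
it removes is any Iwasawa-theoretic LOWER bound at a ¬GV rank-0 curve (the lower bound enters at the anchor as an L-value unit).
The kernel fact is ONE-DIRECTIONAL: the main conjecture propagates BACKWARDS along certified two-steps (no two-way invariance /
«cocycle» is proved or claimed). Nothing about any curve is proved here; BSD is not advanced by this file. [cite: Wuthrich2014, Prop. 21 (p. 400) and Thm. 16 (p. 397)] [cite: Miller2011LMS, Def. 1.1]
[cite: JetchevSkinnerWan2017, §7.4.1] [cite: KellerYin2024, Thm. D (5.1.3) (what certifies a two-step; hypothesis)]
-/

set_option autoImplicit false
set_option linter.dupNamespace false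

noncomputable section

open scoped Classical

open WeierstrassCurve NumberField
  Literature.NumberTheory.EllipticCurves
  Literature.NumberTheory.EllipticCurves.ModularForms
  Literature.NumberTheory.QuadraticFields
  Literature.NumberTheory.EllipticCurves.Rank1Residual
  Literature.NumberTheory.EllipticCurves.Rank1Residual.Typed
  Literature.NumberTheory.EllipticCurves.Wuthrich2014
  Literature.NumberTheory.EllipticCurves.SteinWuthrich2013
  Summit.BirchSwinnertonDyer.Rank1Residual
  Summit.BirchSwinnertonDyer.BirchSwinnertonDyer.Theses
  Summit.BirchSwinnertonDyer.BirchSwinnertonDyer.Theorems.EisensteinPrimesMazurMCOnCellBTwistbackLowerHalf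
  Summit.BirchSwinnertonDyer.BirchSwinnertonDyer.Theorems.EisensteinPrimesMazurMCOnCellBTwistbackUnitLever
  Summit.BirchSwinnertonDyer.BirchSwinnertonDyer.Theorems.SchneiderFree
  Summit.BirchSwinnertonDyer.BirchSwinnertonDyer.Theorems.SchneiderFree.Upper
  Summit.BirchSwinnertonDyer.BirchSwinnertonDyer.Theorems

namespace Summit.BirchSwinnertonDyer.BirchSwinnertonDyer.Cruxes.MazurMCOnCellB.Anchor

/-! ## §0. The graph: certified Heegner two-steps and anchors -/

/-- **CERTIFIED HEEGNER TWO-STEP `W ⇝ W″` at `p`** — binder for binder the data of LEAD UnitLever §4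
`mazurMainConjectureAt_transfer_of_mazurMainConjectureAt` minus the published inputs and minus the main conjecture at
`W″`: `W` an odd multiplicative `E[p]`-reducible rank-`0` pair; an admissible `K` (imaginary quadratic, `d_K` odd `< -4`,
Heegner for `N_W` and `p`) with parametrisation datum `p ∤ c`, Heegner datum and point; a globally minimal model `Wd` of
`E^{(d_K)}` of analytic rank one; STEP L at `(W, K)`; the joint upper half over `(Wd, W″)`; `W″` multiplicative of
analytic rank `0`. A relation on bare curves (instances packed), so that chains are `Relation.ReflTransGen`.
[cite: JetchevSkinnerWan2017, §7.4.1 (STEP L)] [cite: Miller2011LMS, Def. 1.1] -/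
def TwoStep (p : ℕ) [Fact p.Prime] (W W'' : WeierstrassCurve ℚ) : Prop :=
  ∃ (_ : W.IsElliptic) (_ : W.IsGloballyMinimal) (_ : W''.IsElliptic) (_ : W''.IsGloballyMinimal)
    (N : ℕ) (_ : NeZero N) (K : Type) (_ : Field K) (_ : NumberField K)
    (Dt : ModularParametrizationData W N) (H : HeegnerDatum N (NumberField.discr K)) (ι : K →+* ℂ)
    (P : (W.baseChange K).toAffine.Point)
    (Wd : WeierstrassCurve ℚ) (_ : Wd.IsElliptic) (_ : Wd.IsGloballyMinimal),
    IsImaginaryQuadratic K ∧ Odd (NumberField.discr K) ∧ NumberField.discr K < -4 ∧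
    W.conductorNorm ℤ = N ∧ SatisfiesHeegnerHypothesis N K ∧ SatisfiesHeegnerHypothesis p K ∧
    WeierstrassCurve.Affine.Point.map ι.toRatAlgHom P = heegnerPointComplex Dt H ∧ ¬ (p : ℤ) ∣ Dt.c ∧
    p ≠ 2 ∧ W.HasMultiplicativeReductionAtPrime p ∧ ¬ W.HasIrreducibleModPGaloisRep p ∧
    W.analyticRank = 0 ∧
    (∃ C : VariableChange ℚ, C • Wd = W.quadraticTwist (NumberField.discr K : ℚ)) ∧ Wd.analyticRank = 1 ∧
    (Finite (W.baseChange K).sha → X11b.IndexLowerBoundAt W p K P) ∧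
    JointUpperBoundAt Wd W'' p ∧
    W''.HasMultiplicativeReductionAtPrime p ∧ W''.analyticRank = 0

/-- **ANCHOR at `p`**: a globally minimal multiplicative rank-`0` pair where Mazur's main conjecture holds.
[cite: GreenbergLNM1716, §4 (PDF pp. 112–113)] -/
def Anchor (p : ℕ) [Fact p.Prime] (W'' : WeierstrassCurve ℚ) : Prop :=
  ∃ (_ : W''.IsElliptic) (_ : W''.IsGloballyMinimal),
    W''.HasMultiplicativeReductionAtPrime p ∧ W''.analyticRank = 0 ∧ X2.MazurMainConjectureAt W'' p

/-- **ANCHOR SUPPLY (intermediate; NOT a stub).** Every X2b pair `(W, p)` is joined to an anchor by a finite chain of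
certified Heegner two-steps. Modulo `PublishedInputs` this is EQUIVALENT to the crux (⇒: `mazurMCOnCellB_of_anchorSupply`;
⇐: the length-0 chain, `anchorSupply_of_mazurMCOnCellB`) — it is the graph REFORMULATION, typed so that every single-road
supply (twistunit `HeegnerUnitTwist`, record v4 `stub_upperPartner`, UnitLever §4) is visibly a chain of length ≤ 1.
A statement, nothing asserted. [cite: GreenbergLNM1716, §4 (PDF pp. 112–113)] -/
def AnchorSupply : Prop :=
  ∀ (W : WeierstrassCurve ℚ) [W.IsElliptic] [W.IsGloballyMinimal] (p : ℕ) [Fact p.Prime],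
    X2.CellB W p → ∃ W'' : WeierstrassCurve ℚ, Relation.ReflTransGen (TwoStep p) W W'' ∧ Anchor p W''

/-- **UNIT-ANCHOR SUPPLY (the line's ONE open statement).** Every X2b pair `(W, p)` is joined by a finite chain of
certified Heegner two-steps to a globally minimal `E[p]`-REDUCIBLE rank-`0` multiplicative pair `W″` with
`p ∤ #Ш_an(W″)` (a Wuthrich-Prop.-21 anchor: BSD(W″,p) and the main conjecture at `(W″,p)` are then CLOSED IN PRINT,
`anchor_of_unit`). NOT implied by the crux (it asserts unit twists exist along certified chains); implies it
(`mazurMCOnCellB_of_unitAnchorSupply`). Strictly weaker than twistunit v3.1's `HeegnerUnitTwist` on the box (= chains of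
length 1 through the `p ∤ c` member) and than UnitLever §2's per-pair twist-unit datum. Numerically (ANCHOR-CENSUS-g8,
`p = 3`, rev 3): length-1 unit anchors for 46/46 computed X2b classes (N ≤ 900, |d d″| ≤ 79993; 84/94 rank-0 ends are
units at the optimal member; 46 of the 53 X2b classes with N ≤ 900 have an admissible two-step with 4√N·|d d″| ≤ 8·10⁶,
the other 7 none); 537c's first four, 138b's first two and 798e's first admissible ends have analytic rank ≥ 2 and their
units appear only at |d d″| = 1633, 41041, 63961 — so chain length / discriminant size must stay unbounded in the
statement).
OPEN; a statement, nothing asserted. [cite: Wuthrich2014, Prop. 21 (p. 400)]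
[cite: KellerYin2024, Thm. D (5.1.3) (what certifies a two-step; hypothesis)] [cite: KrizLi2019, Prop. 4.8 (rank supply at p = 3)] -/
def UnitAnchorSupply : Prop :=
  ∀ (W : WeierstrassCurve ℚ) [W.IsElliptic] [W.IsGloballyMinimal] (p : ℕ) [Fact p.Prime],
    X2.CellB W p → ∃ W'' : WeierstrassCurve ℚ, Relation.ReflTransGen (TwoStep p) W W'' ∧
      ∃ (_ : W''.IsElliptic) (_ : W''.IsGloballyMinimal),
        W''.HasMultiplicativeReductionAtPrime p ∧ ¬ W''.HasIrreducibleModPGaloisRep p ∧ W''.analyticRank = 0 ∧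
        ∃ q : ℚ, shaAn W'' = (q : ℂ) ∧ padicValRat p q = 0

/-! ## §1. Stubs (`sorry` ONLY here; NOT registered — W-79) -/

/-- PUB: the route's support item (item 19037), as in the record. -/
theorem stub_publishedInputs : EisensteinPrimes.PublishedInputs := by
  sorry

/-- PUB: Wuthrich 2014 Prop. 21 (`#Ш ∣ C·#Ш_an` at rank `0`, `C` supported away from odd multiplicative reducible `p`).
[cite: Wuthrich2014, Prop. 21 (p. 400)] -/
theorem stub_wuthrichProp21 : sha_dvd_analyticSha := by
  sorry

/-- OPEN: unit-anchor supply (the line's one open statement). -/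
theorem stub_unitAnchorSupply : UnitAnchorSupply := by
  sorry

/-! ## §2. Kernel (sorry-free): anchors from units; propagation along chains; the crux BY NAME -/

/-- **Unit ⟹ anchor** (Wuthrich 2014 Prop. 21 `hW21` + Thm. 16 + Stein–Wuthrich + GZK + modularity + Greenberg–Stevens):
a rank-`0`, odd, multiplicative, `E[p]`-reducible pair with `p ∤ #Ш_an` is an anchor.
[cite: Wuthrich2014, Prop. 21 (p. 400) and Thm. 16 (p. 397)] -/
theorem anchor_of_unit (hW21 : sha_dvd_analyticSha)
    (hWu : thm16_charIdeal_dvd_multiplicative_of_reducible)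
    (hJs : thm61_splitMultiplicative) (hJn : thm61_nonsplitMultiplicative)
    (hHs : exists_isSplitMultCanonical) (hHn : exists_isMultCanonical)
    (hGZK : rank_eq_analyticRank_of_analyticRank_le_one) (hmod : hasEntireLFunction_rat)
    (W : WeierstrassCurve ℚ) [W.IsElliptic] [W.IsGloballyMinimal] (p : ℕ) [Fact p.Prime]
    (hGS : greenberg_stevens (W := W) (p := p))
    (hp2 : p ≠ 2) (hmult : W.HasMultiplicativeReductionAtPrime p)
    (hred : ¬ W.HasIrreducibleModPGaloisRep p) (hr : W.analyticRank = 0)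
    (hunit : ∃ q : ℚ, shaAn W = (q : ℂ) ∧ padicValRat p q = 0) : Anchor p W :=
  ⟨inferInstance, inferInstance, hmult, hr,
    X2.mazurMainConjectureAt_of_shaAn_unit_of_red hWu hW21 hJs hJn hHs hHn hGZK hmod W p hGS hp2 hmult hred hr hunit⟩

/-- **One certified two-step carries the anchor property backwards** (LEAD UnitLever §4). -/
theorem anchor_of_twoStep
    (hWu : thm16_charIdeal_dvd_multiplicative_of_reducible)
    (hJs : thm61_splitMultiplicative) (hJn : thm61_nonsplitMultiplicative)
    (hHs : exists_isSplitMultCanonical) (hHn : exists_isMultCanonical)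
    (hGZK : rank_eq_analyticRank_of_analyticRank_le_one) (hmod : hasEntireLFunction_rat)
    (hpar : nonempty_modularParametrizationData)
    (hGSall : ∀ (W : WeierstrassCurve ℚ) [W.IsElliptic] [W.IsGloballyMinimal] (p : ℕ) [Fact p.Prime],
      greenberg_stevens (W := W) (p := p))
    (hGZall : ∀ (N : ℕ) [NeZero N] (W : WeierstrassCurve ℚ) (K : Type) [Field K] [NumberField K],
      gross_zagier N W K)
    (hKoall : ∀ (N : ℕ) [NeZero N] (W : WeierstrassCurve ℚ) (K : Type) [Field K] [NumberField K],
      kolyvagin N W K)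
    (p : ℕ) [Fact p.Prime] {W W'' : WeierstrassCurve ℚ} (hT : TwoStep p W W'') (hA : Anchor p W'') :
    Anchor p W := by
  obtain ⟨eW, mW, e'', m'', N, _, K, _, _, Dt, H, ι, P, Wd, _, _, hK, hodd, hlt, hN, hHN, hHp, hP, hc, hp2, hmult,
    hred, hr, hWd, hrd, hlow, hJU, hmult'', hr''⟩ := hT
  obtain ⟨_, _, -, -, hMC''⟩ := hA
  exact ⟨eW, mW, hmult, hr,
    mazurMainConjectureAt_transfer_of_mazurMainConjectureAt hWu hJs hJn hHs hHn hGZK hmod hpar W p hGSall N K Dt H ι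
      P (hGZall N W K) (hKoall N W K) hK hodd hlt hN hHN hHp hP hc hp2 hmult hred hr Wd hWd hrd hlow W'' hJU hmult''
      hr'' hMC''⟩

/-- **Propagation along any finite chain** (induction on `Relation.ReflTransGen`). -/
theorem anchor_of_reflTransGen
    (hWu : thm16_charIdeal_dvd_multiplicative_of_reducible)
    (hJs : thm61_splitMultiplicative) (hJn : thm61_nonsplitMultiplicative)
    (hHs : exists_isSplitMultCanonical) (hHn : exists_isMultCanonical)
    (hGZK : rank_eq_analyticRank_of_analyticRank_le_one) (hmod : hasEntireLFunction_rat)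
    (hpar : nonempty_modularParametrizationData)
    (hGSall : ∀ (W : WeierstrassCurve ℚ) [W.IsElliptic] [W.IsGloballyMinimal] (p : ℕ) [Fact p.Prime],
      greenberg_stevens (W := W) (p := p))
    (hGZall : ∀ (N : ℕ) [NeZero N] (W : WeierstrassCurve ℚ) (K : Type) [Field K] [NumberField K],
      gross_zagier N W K)
    (hKoall : ∀ (N : ℕ) [NeZero N] (W : WeierstrassCurve ℚ) (K : Type) [Field K] [NumberField K],
      kolyvagin N W K)
    (p : ℕ) [Fact p.Prime] {W W'' : WeierstrassCurve ℚ} (h : Relation.ReflTransGen (TwoStep p) W W'')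
    (hA : Anchor p W'') : Anchor p W := by
  induction h using Relation.ReflTransGen.head_induction_on with
  | refl => exact hA
  | head hT _ ih =>
    exact anchor_of_twoStep hWu hJs hJn hHs hHn hGZK hmod hpar hGSall hGZall hKoall p hT ih

/-- **The crux BY NAME from `PublishedInputs` and `AnchorSupply`.** At an X2b pair take the chain to an anchor
(`AnchorSupply`), propagate (`anchor_of_reflTransGen`), read off the main conjecture at `W`. -/
theorem mazurMCOnCellB_of_anchorSupply (hP : EisensteinPrimes.PublishedInputs) (hS : AnchorSupply) :
    EisensteinPrimes.MazurMCOnCellB := by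
  have hpar := hP.2.2.2.2.1
  have hnf := hP.2.2.2.2.2.1
  have hGZ := hP.2.2.2.2.2.2.2.2.1
  have hKo := hP.2.2.2.2.2.2.2.2.2.1
  have hGZK := hP.2.2.2.2.2.2.2.2.2.2.1
  have hWu := hP.2.2.2.2.2.2.2.2.2.2.2.2.2.2.1
  have hJs := hP.2.2.2.2.2.2.2.2.2.2.2.2.2.2.2.1
  have hJn := hP.2.2.2.2.2.2.2.2.2.2.2.2.2.2.2.2.1
  have hHs := hP.2.2.2.2.2.2.2.2.2.2.2.2.2.2.2.2.2.1
  have hHn := hP.2.2.2.2.2.2.2.2.2.2.2.2.2.2.2.2.2.2.1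
  have hGS := hP.2.2.2.2.2.2.2.2.2.2.2.2.2.2.2.2.2.2.2
  have hmod : WeierstrassCurve.hasEntireLFunction_rat :=
    WeierstrassCurve.hasEntireLFunction_rat_of_exists_isNewformOf hnf
  unfold EisensteinPrimes.MazurMCOnCellB
  intro W _ _ p _ hc
  obtain ⟨W'', hchain, hA⟩ := hS W p hc
  obtain ⟨_, _, -, -, hMC⟩ :=
    anchor_of_reflTransGen hWu hJs hJn hHs hHn hGZK hmod hpar hGS hGZ hKo p hchain hA
  exact hMC

/-- **Converse (length-0 chains): the crux gives `AnchorSupply`** — so `AnchorSupply` is the crux REFORMULATED, not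
weakened; the weakening is `UnitAnchorSupply`. Bookkeeping. -/
theorem anchorSupply_of_mazurMCOnCellB (h : EisensteinPrimes.MazurMCOnCellB) : AnchorSupply := by
  intro W _ _ p _ hc
  exact ⟨W, Relation.ReflTransGen.refl, inferInstance, inferInstance, hc.2.1.2.2, hc.1, h W p hc⟩

/-- **Unit-anchor supply ⟹ anchor supply** (Wuthrich Prop. 21 at the end of the chain; Greenberg–Stevens class-wide
from `PublishedInputs`). -/
theorem anchorSupply_of_unitAnchorSupply (hP : EisensteinPrimes.PublishedInputs) (hW21 : sha_dvd_analyticSha)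
    (hU : UnitAnchorSupply) : AnchorSupply := by
  have hnf := hP.2.2.2.2.2.1
  have hGZK := hP.2.2.2.2.2.2.2.2.2.2.1
  have hWu := hP.2.2.2.2.2.2.2.2.2.2.2.2.2.2.1
  have hJs := hP.2.2.2.2.2.2.2.2.2.2.2.2.2.2.2.1
  have hJn := hP.2.2.2.2.2.2.2.2.2.2.2.2.2.2.2.2.1
  have hHs := hP.2.2.2.2.2.2.2.2.2.2.2.2.2.2.2.2.2.1
  have hHn := hP.2.2.2.2.2.2.2.2.2.2.2.2.2.2.2.2.2.2.1
  have hGS := hP.2.2.2.2.2.2.2.2.2.2.2.2.2.2.2.2.2.2.2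
  have hmod : WeierstrassCurve.hasEntireLFunction_rat :=
    WeierstrassCurve.hasEntireLFunction_rat_of_exists_isNewformOf hnf
  intro W _ _ p _ hc
  obtain ⟨W'', hchain, e'', m'', hmult'', hred'', hr'', hunit⟩ := hU W p hc
  exact ⟨W'', hchain, @anchor_of_unit hW21 hWu hJs hJn hHs hHn hGZK hmod W'' e'' m'' p _ (hGS W'' p) hc.2.1.1
    hmult'' hred'' hr'' hunit⟩

/-- **The crux BY NAME from `PublishedInputs`, Wuthrich Prop. 21 and `UnitAnchorSupply`.** -/
theorem mazurMCOnCellB_of_unitAnchorSupply (hP : EisensteinPrimes.PublishedInputs) (hW21 : sha_dvd_analyticSha)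
    (hU : UnitAnchorSupply) : EisensteinPrimes.MazurMCOnCellB :=
  mazurMCOnCellB_of_anchorSupply hP (anchorSupply_of_unitAnchorSupply hP hW21 hU)

/-! ## §3. The composition from the three stubs -/

/-- The crux BY NAME from the stubs (PUB `stub_publishedInputs`, PUB `stub_wuthrichProp21`, OPEN
`stub_unitAnchorSupply`). -/
theorem MazurMCOnCellB_of : EisensteinPrimes.MazurMCOnCellB :=
  mazurMCOnCellB_of_unitAnchorSupply stub_publishedInputs stub_wuthrichProp21 stub_unitAnchorSupply

end Summit.BirchSwinnertonDyer.BirchSwinnertonDyer.Cruxes.MazurMCOnCellB.Anchor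

end
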